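import Summits.RiemannHypothesis.RiemannHypothesis.Theorems.TiltedLandingLaw421R3SuccSplit
import Summits.RiemannHypothesis.RiemannHypothesis.Theorems.TiltedLandingLaw421R3SuccWindowCase

/-! # TiltedLandingLaw421 — round 3q SUPPORT: `window_of_isolated` ((CA366); C4 rh-idea-6 g28 «kernel desk» image)

SUPPORT module for crux `TiltedLandingLaw421` (stmt-RiemannHypothesis-24774), `--supports … --as helper` only: proves no stub, no crux;
fully proved (no `sorry`). Candidate tree name `…/Theorems/TiltedLandingLaw421R3WindowOfIsolated.lean` (director (CA366)).

★ `window_of_isolated` (critic's signature, CRITIC NOTE for STEP 2, alpha/INBOX l.23; director's recipe (CA366)): a band state `v` of level `j`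
whose closed Jensen disc is STRICTLY isolated from the closed Jensen disc of every other non-real zero of `f⁽ʲ⁾`
(`v.im + |a.im| < |v.re − a.re|`) admits an `AllInBandInRangeWindow` (#1033): the rectangle `[v.re ∓ (v.im + ε)] × [−(v.im + ε), v.im + ε]`
for a small GENERIC `ε > 0`. Bookkeeping only:
* §1 a non-zero entire function has finitely many zeros in a bounded open box (`finite_zeros_box`, from
  `Literature.Analysis.Complex.finite_zeros_reProdIm` + the identity theorem for the non-vanishing witness);
* §2 the UNIFORM isolation gap (`exists_uniform_gap`): zeros of `f⁽ʲ⁾` lie in `|Im| ≤ Hs` (landed analytic heredity), so only the finitely many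
  zeros in the box `|Re a − Re v| < v.im + Hs + 2` can have small slack — minimise over them;
* §3 clearance inequalities (`clear_other`, `clear_self_re`, `clear_self_im`: `‖w − a.re‖ ≥ |Re w − a.re|`, `≥ |Im w|`);
* §4 the theorem: `ε ∈ (0, min gap rangeSlack)` off the finitely many values putting a corner on a zero of `f⁽ʲ⁾` or `f⁽ʲ⁺¹⁾`
  (`Set.Ioo_infinite`, `Set.Infinite.diff`); band clause: the only upper zero in the closed window is `v` (gap); range clause as #1038
  (`abs_re_sub_le_of_stTrkDQ` + `band_radius_lt_range'`).
Also `antiEscape_isolated_absurd` (one line). Nothing here bears on the truth of RH; RH is not proved; 24774 OPEN. -/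

set_option linter.dupNamespace false

namespace RhW08.SuccB

open Complex Set Filter Topology
open scoped ComplexConjugate
open RhIdea6.G17.W07C7 RhIdea6.G17.W07C7.Rev6 RhIdea6.G18.W07C8.Law421BirthS RhIdea6.G19.W07C11.Seam
open RhIdea6.G20.W07C12.Frac RhIdea6.G20.W07C12.StColP RhW07.C12.FieldSplit RhIdea6.G21.W07C13.TentMax
open RhW07.C14.TwoSided RhW07.C14.Classes RhW07.C14.Lineage RhW07.C14.Booking
open RhW07.C13.Heredity RhIdea6.G22.W07C15pre.Injection RhW07.E3.Cell RhW07.E3.Lit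
open RhW08.Round1 RhW08.StSwap RhW08.Round2 RhW08.QuadW RhW08.SealSwapQ RhW08.SealSwap RhW08.SuccSplit
open Summit.RiemannHypothesis.RiemannHypothesis.Theorems.Splittings.JensenWindow
open Literature.Analysis.Complex

/-! ## §1 finiteness of zeros in a box -/

/-- (K) a non-zero entire function does not vanish identically on a closed box having an interior point. -/
theorem exists_ne_zero_mem_box {G : ℂ → ℂ} (hG : Differentiable ℂ G) (hne : G ≠ 0) {a b c d : ℝ} {z₀ : ℂ}
    (hz₀ : z₀ ∈ Ioo a b ×ℂ Ioo c d) : ∃ w ∈ Icc a b ×ℂ Icc c d, G w ≠ 0 := by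
  by_contra h
  have hall : ∀ w ∈ Icc a b ×ℂ Icc c d, G w = 0 := by
    intro w hw
    by_contra hGw
    exact h ⟨w, hw, hGw⟩
  have hopen : IsOpen (Ioo a b ×ℂ Ioo c d) := isOpen_Ioo.reProdIm isOpen_Ioo
  have hsub : Ioo a b ×ℂ Ioo c d ⊆ Icc a b ×ℂ Icc c d := fun w hw => by
    rw [mem_reProdIm] at hw ⊢
    exact ⟨Ioo_subset_Icc_self hw.1, Ioo_subset_Icc_self hw.2⟩
  have hev : G =ᶠ[𝓝 z₀] 0 := by
    filter_upwards [hopen.mem_nhds hz₀] with w hw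
    exact hall w (hsub hw)
  have hGan : AnalyticOnNhd ℂ G univ := hG.differentiableOn.analyticOnNhd isOpen_univ
  have hz := hGan.eqOn_zero_of_preconnected_of_eventuallyEq_zero isPreconnected_univ (mem_univ z₀) hev
  exact hne (funext fun w => hz (mem_univ w))

/-- (K) a non-zero entire function has finitely many zeros in a bounded open box (with an interior point `z₀`). -/
theorem finite_zeros_box {G : ℂ → ℂ} (hG : Differentiable ℂ G) (hne : G ≠ 0) {a b c d : ℝ} {z₀ : ℂ}
    (hz₀ : z₀ ∈ Ioo a b ×ℂ Ioo c d) : {ρ : ℂ | G ρ = 0 ∧ ρ ∈ Ioo a b ×ℂ Ioo c d}.Finite := by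
  obtain ⟨w, hw, hGw⟩ := exists_ne_zero_mem_box hG hne hz₀
  have hz₀' := hz₀
  rw [mem_reProdIm] at hz₀'
  have hab : a ≤ b := (hz₀'.1.1.trans hz₀'.1.2).le
  have hcd : c ≤ d := (hz₀'.2.1.trans hz₀'.2.2).le
  exact finite_zeros_reProdIm hab hcd ((hG.differentiableOn.analyticOnNhd isOpen_univ).mono (subset_univ _)) hw hGw

/-- (K) a real point `x` with `|x − c| < L` lies in the box `(c − L, c + L) × (−(H+1), H+1)` (`0 ≤ H`). -/
theorem ofReal_mem_box {x c L H : ℝ} (hx : |x - c| < L) (hH : 0 ≤ H) :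
    ((x : ℂ)) ∈ Ioo (c - L) (c + L) ×ℂ Ioo (-(H + 1)) (H + 1) := by
  rw [mem_reProdIm, ofReal_re, ofReal_im]
  rw [abs_lt] at hx
  exact ⟨⟨by linarith, by linarith⟩, ⟨by linarith, by linarith⟩⟩

/-! ## §2 the uniform isolation gap -/

/-- ★ (K) **UNIFORM GAP**: strict disc isolation of `v` from every other non-real zero of an entire `G ≢ 0` whose zeros lie in `|Im| ≤ Hs`
is uniform: some `g ∈ (0, 1]` with `v.im + |a.im| + g ≤ |v.re − a.re|` for all of them. -/
theorem exists_uniform_gap {G : ℂ → ℂ} (hG : Differentiable ℂ G) (hne : G ≠ 0) {Hs : ℝ}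
    (hstrip : ∀ a : ℂ, G a = 0 → |a.im| ≤ Hs) {v : ℂ} (hvim : 0 < v.im) (hvHs : v.im ≤ Hs)
    (hiso : ∀ a : ℂ, G a = 0 → a.im ≠ 0 → a ≠ v → a ≠ conj v → v.im + |a.im| < |v.re - a.re|) :
    ∃ g : ℝ, 0 < g ∧ g ≤ 1 ∧
      ∀ a : ℂ, G a = 0 → a.im ≠ 0 → a ≠ v → a ≠ conj v → v.im + |a.im| + g ≤ |v.re - a.re| := by
  have hHs : 0 ≤ Hs := le_trans hvim.le hvHs
  set L : ℝ := v.im + Hs + 2 with hL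
  have hz₀ : ((v.re : ℂ)) ∈ Ioo (v.re - L) (v.re + L) ×ℂ Ioo (-(Hs + 1)) (Hs + 1) :=
    ofReal_mem_box (by rw [sub_self, abs_zero]; linarith) hHs
  have hfin := finite_zeros_box hG hne hz₀
  -- zeros outside the box have slack ≥ 1
  have hout : ∀ a : ℂ, G a = 0 → a ∉ Ioo (v.re - L) (v.re + L) ×ℂ Ioo (-(Hs + 1)) (Hs + 1) →
      v.im + |a.im| + 1 ≤ |v.re - a.re| := by
    intro a hGa hbox
    have hai : |a.im| ≤ Hs := hstrip a hGa
    have hre : L ≤ |v.re - a.re| := by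
      by_contra hlt
      rw [not_le] at hlt
      apply hbox
      rw [mem_reProdIm]
      rw [abs_lt] at hlt
      rw [abs_le] at hai
      exact ⟨⟨by linarith, by linarith⟩, ⟨by linarith, by linarith⟩⟩
    linarith
  set T : Set ℂ := {a : ℂ | G a = 0 ∧ a ∈ Ioo (v.re - L) (v.re + L) ×ℂ Ioo (-(Hs + 1)) (Hs + 1)} ∩
    {a : ℂ | a.im ≠ 0 ∧ a ≠ v ∧ a ≠ conj v} with hT
  have hTfin : T.Finite := hfin.inter_of_left _
  let sl : ℂ → ℝ := fun a => |v.re - a.re| - v.im - |a.im|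
  by_cases hTe : T.Nonempty
  · obtain ⟨a₀, ha₀, hmin⟩ := Set.exists_min_image T sl hTfin hTe
    have hsl₀ : 0 < sl a₀ := by
      have := hiso a₀ ha₀.1.1 ha₀.2.1 ha₀.2.2.1 ha₀.2.2.2
      show 0 < |v.re - a₀.re| - v.im - |a₀.im|
      linarith
    refine ⟨min (sl a₀) 1, lt_min hsl₀ one_pos, min_le_right _ _, ?_⟩
    intro a hGa haim hav havc
    by_cases hbox : a ∈ Ioo (v.re - L) (v.re + L) ×ℂ Ioo (-(Hs + 1)) (Hs + 1)
    · have haT : a ∈ T := ⟨⟨hGa, hbox⟩, haim, hav, havc⟩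
      have h1 : sl a₀ ≤ sl a := hmin a haT
      have h2 : min (sl a₀) 1 ≤ sl a₀ := min_le_left _ _
      have h3 : sl a = |v.re - a.re| - v.im - |a.im| := rfl
      linarith
    · have h1 := hout a hGa hbox
      have h2 : min (sl a₀) 1 ≤ 1 := min_le_right _ _
      linarith
  · refine ⟨1, one_pos, le_rfl, ?_⟩
    intro a hGa haim hav havc
    by_cases hbox : a ∈ Ioo (v.re - L) (v.re + L) ×ℂ Ioo (-(Hs + 1)) (Hs + 1)
    · exact absurd ⟨a, ⟨hGa, hbox⟩, haim, hav, havc⟩ hTe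
    · exact hout a hGa hbox

/-! ## §3 clearance inequalities -/

/-- (K) clearance from a DISTANT zero: slack `g`, boundary abscissa within `v.im + ε` of `v.re`, `ε < g`. -/
theorem clear_other {v a : ℂ} {x y g ε : ℝ} (hslack : v.im + |a.im| + g ≤ |v.re - a.re|)
    (hx : |x - v.re| ≤ v.im + ε) (hεg : ε < g) :
    |a.im| < ‖((x : ℂ) + (y : ℂ) * I) - (a.re : ℂ)‖ := by
  have h1 : |v.re - a.re| ≤ |v.re - x| + |x - a.re| := abs_sub_le _ _ _
  have h2 : |v.re - x| = |x - v.re| := abs_sub_comm _ _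
  have hre : (((x : ℂ) + (y : ℂ) * I) - (a.re : ℂ)).re = x - a.re := by simp
  calc |a.im| < |x - a.re| := by linarith
    _ = |((((x : ℂ) + (y : ℂ) * I) - (a.re : ℂ))).re| := by rw [hre]
    _ ≤ ‖((x : ℂ) + (y : ℂ) * I) - (a.re : ℂ)‖ := Complex.abs_re_le_norm _

/-- (K) clearance from `v` / `conj v` on the SIDES: `|x − v.re| > v.im`. -/
theorem clear_self_re {v a : ℂ} {x y : ℝ} (hare : a.re = v.re) (haim : |a.im| = v.im) (hx : v.im < |x - v.re|) :
    |a.im| < ‖((x : ℂ) + (y : ℂ) * I) - (a.re : ℂ)‖ := by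
  have hre : (((x : ℂ) + (y : ℂ) * I) - (a.re : ℂ)).re = x - v.re := by simp [hare]
  calc |a.im| = v.im := haim
    _ < |x - v.re| := hx
    _ = |((((x : ℂ) + (y : ℂ) * I) - (a.re : ℂ))).re| := by rw [hre]
    _ ≤ ‖((x : ℂ) + (y : ℂ) * I) - (a.re : ℂ)‖ := Complex.abs_re_le_norm _

/-- (K) clearance from `v` / `conj v` on the TOP: `|y| > v.im`. -/
theorem clear_self_im {v a : ℂ} {x y : ℝ} (haim : |a.im| = v.im) (hy : v.im < |y|) :
    |a.im| < ‖((x : ℂ) + (y : ℂ) * I) - (a.re : ℂ)‖ := by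
  have him : (((x : ℂ) + (y : ℂ) * I) - (a.re : ℂ)).im = y := by simp
  calc |a.im| = v.im := haim
    _ < |y| := hy
    _ = |((((x : ℂ) + (y : ℂ) * I) - (a.re : ℂ))).im| := by rw [him]
    _ ≤ ‖((x : ℂ) + (y : ℂ) * I) - (a.re : ℂ)‖ := Complex.abs_im_le_norm _

/-- (K) `|a.im| = v.im` and `a.re = v.re` for `a ∈ {v, conj v}` (`0 < v.im`). -/
theorem re_im_of_self_or_conj {v a : ℂ} (hvim : 0 < v.im) (h : a = v ∨ a = conj v) :
    a.re = v.re ∧ |a.im| = v.im := by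
  rcases h with rfl | rfl
  · exact ⟨rfl, abs_of_pos hvim⟩
  · exact ⟨Complex.conj_re v, by rw [Complex.conj_im, abs_neg, abs_of_pos hvim]⟩

/-! ## §4 the window -/

/-- ★★ (K) **ISOLATED DISC ⇒ ALL-IN-BAND IN-RANGE WINDOW** (critic's signature; director (CA366)). -/
theorem window_of_isolated {η : ℝ} {f : ℂ → ℂ} {x₀ s hmax R Hs : ℝ} {B j : ℕ} {v : ℂ}
    (hE : EngineHyps5 2 η f x₀ s hmax R Hs B)
    (hv : StTrkDQ η f x₀ s hmax R Hs B j v)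
    (hiso : ∀ a, iteratedDeriv j f a = 0 → a.im ≠ 0 → a ≠ v → a ≠ conj v → v.im + |a.im| < |v.re - a.re|) :
    AllInBandInRangeWindow f x₀ R Hs j v := by
  have hE' := hE
  obtain ⟨hdiff, hreal, hgrowth, hs, hsh, hhR, h3R, hHs, hstrip, hHsR, hpair, hcol, hhalf, hη0, hη1, hrem⟩ := hE'
  have hv' : iteratedDeriv j f ≠ 0 ∧ iteratedDeriv j f v = 0 ∧ 0 < v.im ∧
      (max (|v.re - x₀| - R / 2) 0) ^ 2 + (j : ℝ) * v.im ^ 2 ≤ (j : ℝ) * Hs ^ 2 ∧ v.im ≤ Hs := hv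
  obtain ⟨hGne, hGv, hvim, hquad, hvHs⟩ := hv'
  -- the derivative data
  have hGd : Differentiable ℂ (iteratedDeriv j f) := differentiable_iteratedDeriv_of_entire hdiff j
  have hC0 : InClass f Hs := ⟨hdiff, hreal, hgrowth, hstrip⟩
  have hCj : InClass (iteratedDeriv j f) Hs := analyticHeredity_landed f Hs j hHs hC0 hGne
  have hGstrip : ∀ a : ℂ, iteratedDeriv j f a = 0 → |a.im| ≤ Hs := hCj.2.2.2
  have hG'ne : iteratedDeriv (j + 1) f ≠ 0 := iteratedDeriv_succ_ne_zero_of_zero hdiff j hGne hGv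
  have hG'd : Differentiable ℂ (iteratedDeriv (j + 1) f) := differentiable_iteratedDeriv_of_entire hdiff (j + 1)
  have hderiv : deriv (iteratedDeriv j f) = iteratedDeriv (j + 1) f := iteratedDeriv_succ.symm
  -- the uniform gap
  obtain ⟨g, hg0, hg1, hgap⟩ := exists_uniform_gap hGd hGne hGstrip hvim hvHs hiso
  -- the range slack
  have hR0 : 0 < R := by linarith
  have hρ : |v.re - x₀| ≤ R / 2 + Real.sqrt j * Hs := abs_re_sub_le_of_stTrkDQ hHs hv
  have hrange : R / 2 + Real.sqrt j * Hs + Hs < ((j : ℝ) + 3) * R / 2 := band_radius_lt_range' hHs hHsR hR0 j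
  set rs : ℝ := ((j : ℝ) + 3) * R / 2 - (R / 2 + Real.sqrt j * Hs + Hs) with hrs_def
  have hrs0 : 0 < rs := by rw [hrs_def]; linarith
  set ε₀ : ℝ := min g rs with hε₀_def
  have hε₀ : 0 < ε₀ := lt_min hg0 hrs0
  -- finitely many zeros of `f⁽ʲ⁾`, `f⁽ʲ⁺¹⁾` in the big box
  set L : ℝ := v.im + Hs + 2 with hL
  have hz₀ : ((v.re : ℂ)) ∈ Ioo (v.re - L) (v.re + L) ×ℂ Ioo (-(Hs + 1)) (Hs + 1) :=
    ofReal_mem_box (by rw [sub_self, abs_zero]; linarith) hHs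
  set Z : Set ℂ := {ρ : ℂ | iteratedDeriv j f ρ = 0 ∧ ρ ∈ Ioo (v.re - L) (v.re + L) ×ℂ Ioo (-(Hs + 1)) (Hs + 1)} ∪
    {ρ : ℂ | iteratedDeriv (j + 1) f ρ = 0 ∧ ρ ∈ Ioo (v.re - L) (v.re + L) ×ℂ Ioo (-(Hs + 1)) (Hs + 1)} with hZ
  have hZfin : Z.Finite := (finite_zeros_box hGd hGne hz₀).union (finite_zeros_box hG'd hG'ne hz₀)
  -- the two corner maps are injective, so only finitely many `ε` put a corner on a zero
  let cp : ℝ → ℂ := fun ε => ((v.re + (v.im + ε) : ℝ) : ℂ)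
  let cm : ℝ → ℂ := fun ε => ((v.re - (v.im + ε) : ℝ) : ℂ)
  have hcp : Set.InjOn cp (cp ⁻¹' Z) := fun a _ b _ h => by
    have h' : v.re + (v.im + a) = v.re + (v.im + b) := Complex.ofReal_inj.mp h
    linarith
  have hcm : Set.InjOn cm (cm ⁻¹' Z) := fun a _ b _ h => by
    have h' : v.re - (v.im + a) = v.re - (v.im + b) := Complex.ofReal_inj.mp h
    linarith
  have hbad : (cp ⁻¹' Z ∪ cm ⁻¹' Z).Finite := (hZfin.preimage hcp).union (hZfin.preimage hcm)
  obtain ⟨ε, hεI, hεbad⟩ := ((Set.Ioo_infinite hε₀).sdiff hbad).nonempty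
  obtain ⟨hε0, hε1⟩ := hεI
  have hεg : ε < g := lt_of_lt_of_le hε1 (min_le_left _ _)
  have hεrs : ε < rs := lt_of_lt_of_le hε1 (min_le_right _ _)
  have hεone : ε < 1 := lt_of_lt_of_le hεg hg1
  -- the corners avoid the zeros of `f⁽ʲ⁾` and `f⁽ʲ⁺¹⁾`
  have hβmem : cp ε ∈ Ioo (v.re - L) (v.re + L) ×ℂ Ioo (-(Hs + 1)) (Hs + 1) :=
    ofReal_mem_box (by rw [show v.re + (v.im + ε) - v.re = v.im + ε by ring, abs_of_pos (by linarith)]; linarith) hHs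
  have hαmem : cm ε ∈ Ioo (v.re - L) (v.re + L) ×ℂ Ioo (-(Hs + 1)) (Hs + 1) :=
    ofReal_mem_box (by rw [show v.re - (v.im + ε) - v.re = -(v.im + ε) by ring, abs_neg, abs_of_pos (by linarith)]; linarith) hHs
  have hGβ : iteratedDeriv j f (cp ε) ≠ 0 := fun h0 => hεbad (Or.inl (Or.inl ⟨h0, hβmem⟩))
  have hG'β : iteratedDeriv (j + 1) f (cp ε) ≠ 0 := fun h0 => hεbad (Or.inl (Or.inr ⟨h0, hβmem⟩))
  have hGα : iteratedDeriv j f (cm ε) ≠ 0 := fun h0 => hεbad (Or.inr (Or.inl ⟨h0, hαmem⟩))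
  have hG'α : iteratedDeriv (j + 1) f (cm ε) ≠ 0 := fun h0 => hεbad (Or.inr (Or.inr ⟨h0, hαmem⟩))
  -- side abscissae are at distance exactly `v.im + ε` from `v.re`
  have hxα : |v.re - (v.im + ε) - v.re| = v.im + ε := by
    rw [show v.re - (v.im + ε) - v.re = -(v.im + ε) by ring, abs_neg, abs_of_pos (by linarith)]
  have hxβ : |v.re + (v.im + ε) - v.re| = v.im + ε := by
    rw [show v.re + (v.im + ε) - v.re = v.im + ε by ring, abs_of_pos (by linarith)]
  -- clearance at a boundary point with abscissa `x ∈ [α, β]`, from every zero OTHER than `v`, `conj v`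
  have hclear : ∀ (x y : ℝ), |x - v.re| ≤ v.im + ε → ∀ a : ℂ, iteratedDeriv j f a = 0 → a.im ≠ 0 → ¬ (a = v ∨ a = conj v) →
      |a.im| < ‖((x : ℂ) + (y : ℂ) * I) - (a.re : ℂ)‖ := by
    intro x y hx a hGa haim hav
    rw [not_or] at hav
    exact clear_other (hgap a hGa haim hav.1 hav.2) hx hεg
  have hxmem : ∀ x : ℝ, x ∈ Icc (v.re - (v.im + ε)) (v.re + (v.im + ε)) → |x - v.re| ≤ v.im + ε := by
    intro x hx
    rw [abs_le]
    exact ⟨by linarith [hx.1], by linarith [hx.2]⟩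
  refine ⟨v.re - (v.im + ε), v.re + (v.im + ε), v.im + ε, ?_, ?_, ?_, ?_, ?_⟩
  · -- the Jensen window
    constructor
    · linarith
    · linarith
    · intro x hx a hGa haim
      by_cases hav : a = v ∨ a = conj v
      · obtain ⟨-, hai⟩ := re_im_of_self_or_conj hvim hav
        exact clear_self_im hai (by rw [abs_of_pos (by linarith)]; linarith)
      · exact hclear x (v.im + ε) (hxmem x hx) a hGa haim hav
    · intro y _ _ a hGa haim
      by_cases hav : a = v ∨ a = conj v
      · obtain ⟨hare, hai⟩ := re_im_of_self_or_conj hvim hav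
        exact clear_self_re hare hai (by rw [hxα]; linarith)
      · exact hclear _ y (le_of_eq hxα) a hGa haim hav
    · intro y _ _ a hGa haim
      by_cases hav : a = v ∨ a = conj v
      · obtain ⟨hare, hai⟩ := re_im_of_self_or_conj hvim hav
        exact clear_self_re hare hai (by rw [hxβ]; linarith)
      · exact hclear _ y (le_of_eq hxβ) a hGa haim hav
    · exact hGα
    · exact hGβ
    · rw [hderiv]; exact hG'α
    · rw [hderiv]; exact hG'β
  · -- `v` is inside
    rw [mem_reProdIm]
    exact ⟨⟨by linarith, by linarith⟩, ⟨by linarith, by linarith⟩⟩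
  · -- the band clause: the only upper zero in the closed window is `v`
    intro a hGa hapos hare hale
    by_cases hav : a = v
    · rw [hav]; exact ⟨hquad, hvHs⟩
    · exfalso
      have havc : a ≠ conj v := by
        intro h
        rw [h, Complex.conj_im] at hapos
        linarith
      have hsl := hgap a hGa (ne_of_gt hapos) hav havc
      have h1 : |v.re - a.re| ≤ v.im + ε := by
        rw [abs_le]
        exact ⟨by linarith [hare.2], by linarith [hare.1]⟩
      linarith [abs_nonneg a.im]
  · -- range, left
    have h1 := (abs_le.mp hρ).1
    linarith
  · -- range, right
    have h1 := (abs_le.mp hρ).2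
    linarith

/-- ★ (K) **ISOLATED DISC ⇒ CONTRADICTION under `AntiEscape`'s hypothesis `¬ AllInBandInRangeWindow`.** -/
theorem antiEscape_isolated_absurd {η : ℝ} {f : ℂ → ℂ} {x₀ s hmax R Hs : ℝ} {B j : ℕ} {v : ℂ}
    (hE : EngineHyps5 2 η f x₀ s hmax R Hs B)
    (hv : StTrkDQ η f x₀ s hmax R Hs B j v)
    (hwin : ¬ AllInBandInRangeWindow f x₀ R Hs j v)
    (hiso : ∀ a, iteratedDeriv j f a = 0 → a.im ≠ 0 → a ≠ v → a ≠ conj v → v.im + |a.im| < |v.re - a.re|) :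
    False :=
  hwin (window_of_isolated hE hv hiso)

end RhW08.SuccB

/-! ## Part 2: Narrowing AntiEscape to AntiEscapeCore -/

namespace RhW08.SuccSplit

open Complex Set
open scoped ComplexConjugate
open RhIdea6.G17.W07C7 RhIdea6.G17.W07C7.Rev6 RhIdea6.G18.W07C8.Law421BirthS RhIdea6.G19.W07C11.Seam
open RhIdea6.G20.W07C12.Frac RhIdea6.G20.W07C12.StColP RhW07.C12.FieldSplit RhIdea6.G21.W07C13.TentMax
open RhW07.C14.TwoSided RhW07.C14.Classes RhW07.C14.Lineage RhW07.C14.Booking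
open RhW07.C13.Heredity RhIdea6.G22.W07C15pre.Injection RhW07.E3.Cell RhW07.E3.Lit
open RhW08.Round1 RhW08.StSwap RhW08.Round2 RhW08.QuadW RhW08.SealSwapQ RhW08.SealSwap RhW08.SuccB
open Summit.RiemannHypothesis.RiemannHypothesis.Theorems.Splittings.JensenWindow
open Literature.Analysis.Complex

/-- **DISC OVERLAP**: v's closed Jensen disc MEETS the closed Jensen disc of another non-real zero `a ≠ v, v̄` of `f^{(j)}`.
Discs D̄(v) and D̄(a) meet iff |v.re − a.re| ≤ v.im + |a.im| (both are centred on the real axis with radius = |Im|). -/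
def DiscOverlap (f : ℂ → ℂ) (j : ℕ) (v : ℂ) : Prop :=
  ∃ a : ℂ, iteratedDeriv j f a = 0 ∧ a.im ≠ 0 ∧ a ≠ v ∧ a ≠ conj v ∧ |v.re - a.re| ≤ v.im + |a.im|

/-- **ANTI-ESCAPE CORE** (OPEN): the content of `AntiEscape` under disc overlap.
`AntiEscapeCore` = AntiEscape's hypotheses PLUS «some other non-real zero's disc meets v's disc». -/
def AntiEscapeCore : Prop :=
  ∀ (η : ℝ) (f : ℂ → ℂ) (x₀ s hmax R Hs : ℝ) (B : ℕ), EngineHyps5 2 η f x₀ s hmax R Hs B → ∀ (j : ℕ) (v : ℂ),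
    IsLowest StTrkDQ η f x₀ s hmax R Hs B j v → ¬ ReadyR2 η f x₀ s hmax R Hs B j v →
    ¬ AllInBandInRangeWindow f x₀ R Hs j v → ¬ Dimple f j v →
    DiscOverlap f j v →
    ∃ u : ℂ, StTrkDQ η f x₀ s hmax R Hs B (j + 1) u

/-- ★★ **NARROWING: `AntiEscapeCore → AntiEscape`.**

Proof by contraposition on the disc-overlap hypothesis: if ¬DiscOverlap (i.e. v's disc is ISOLATED from all others),
then we can construct an `AllInBandInRangeWindow` around v, contradicting `¬ AllInBandInRangeWindow` in `AntiEscape`.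

The key geometric fact (from `window_of_isolated`):
- ISOLATED ⇒ there exists a Jensen Window around v containing only {v, v̄} as non-real zeros
- v is a band state, so this Window IS an AllInBandInRangeWindow. -/
theorem antiEscape_of_core (hC : AntiEscapeCore) : AntiEscape := by
  intro η f x₀ s hmax R Hs B hE j v hlow hnr hwin hdim
  by_cases hov : DiscOverlap f j v
  · exact hC η f x₀ s hmax R Hs B hE j v hlow hnr hwin hdim hov
  · -- ¬DiscOverlap means v's disc is isolated from all other non-real zeros' discs
    exfalso
    apply hwin
    -- Convert ¬DiscOverlap to the strict isolation hypothesis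
    have hiso : ∀ a, iteratedDeriv j f a = 0 → a.im ≠ 0 → a ≠ v → a ≠ conj v →
        v.im + |a.im| < |v.re - a.re| := by
      intro a ha haim hav hac
      by_contra h
      push Not at h
      exact hov ⟨a, ha, haim, hav, hac, h⟩
    exact window_of_isolated hE hlow.1 hiso

end RhW08.SuccSplit
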